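import Summits.QuantumFields.YangMills.Theorems.FluctuationComparisonRegPrIntLS2BetaTubeGrowthOfIsolated
import Summits.QuantumFields.YangMills.Theorems.FluctuationComparisonRegPrIntLOrbBarOfRegArgminBar
import HarnessLib

/-!
# ISOL∘(δ) ⟸ ORB̄ — THE ISOLATION LETTER OF THE TUBE DOOR IS THE CLOSED-WINDOW ORBIT LETTER; HENCE GAP♭ ⟸ {POS∘, ORB̄} ⟸ {POS∘, PROP. 7 CL. 1, REG-ARGMIN̄, CL}
# (crux `FluctuationComparisonRegPrIntL`, stmt-QuantumFields-20520; registry v11.4 `Cruxes/FluctuationComparisonRegPrIntL/Lines/semiclassical_s2beta.lean` 3732b7df FROZEN, untouched)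

Cell `ym3-torus` (YM ladder rung R3 = continuum `SU(2)` Yang–Mills on the three-torus — a RUNG: NOT d = 4, NOT infinite volume, NOT a mass gap, NOT Clay).
Seat `ym3-torus-px17` (gen 14), ORB̄ ∕ MB side of LEAD w3 g23's division (WORD №17 (i)); `--kind proof --supports stmt-QuantumFields-20520 --as helper`, count-neutral,
DEFINITION-FREE (0 `def`, 0 `instance`, 0 `notation`, 0 `sorry`, default heartbeats).

WHY.  px8 g18's tube door ✓`…S2BetaTubeGrowthOfIsolated.gapFlatAt_of_pos_of_isolated_of_closePair` reads the per-datum gap GAP♭(V,U₀) from TWO displayed letters on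
`closure (fibre ∩ histGood) ∩ {δ-tube}`: POS∘(U₀) (collar growth `D ≤ r ⇒ c·D ≤ A − min`, print's (142)) and ISOL∘(δ) (`A ≤ min ⇒ D = 0`, «inside the closed `δ`-tube the
(6)-minimum is reached only on the orbit»).  The second letter is NOT independent of the uniqueness letters already of record: the closed-window orbit letter ORB̄(V,U₀) of
✓`…GapFlatOfOrbBarMorseBott` ∕ ✓`…OrbBarOfRegArgminBar` («every `U ∈ closure (fibre ∩ histGood)` with `A U ≤ min` is a residual translate `w • U₀`») gives ISOL∘(δ) for EVERY `δ`
at once, because the orbit functional `D U = ⨅_{w residual} Σ_ℓ dist1 (U ℓ·((w•U₀) ℓ)⁻¹)²` vanishes on the residual orbit (✓`…S2BetaResidualGaugeOrbit.iInf_orbitDistSq_eq_zero_of_residual`);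
and ORB̄ ⟸ {Prop. 7 cl. 1, REG-ARGMIN̄, CL} is ✓`orbBar_of_atMostOneCriticalOrbit` (flat corner ✓`orbBar_one_of_prop7At`).  So on the per-datum path the organ's residue is
POS∘ + the uniqueness letters of record — ISOL∘ is discharged, not displayed.

WHAT.
* §1 ★★ `isol_of_orbBar` — ISOL∘(δ) (px8's `hisol` text, token for token) for every `δ`, from ORB̄ (px17's `hOrb` text, token for token); ★★ `tubeFlatAt_of_pos_of_orbBar` —
  TUBE♭(V,U₀) ⟸ POS∘ ∧ ORB̄ (✓`tubeGrowth_of_pos_of_isolated` with `hisol` discharged).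
* §2 ★★★ `gapFlatAt_of_pos_of_orbBar_of_closePair` — for `γ ≤ γ₁(L, b₀, p₀, δ)` of ✓`closePair_holds`: POS∘(U₀) on the `δ`-tube collar ∧ ORB̄(V,U₀), at a base point `U₀`
  which is a good history of the fibre ⟹ GAP♭(V,U₀) (px17's conclusion text of ✓`gapFlatAt_of_orbBar_of_morseBott`); compare ✓`gapFlatAt_of_orbBar_of_morseBott`, whose growth
  letter `hMB` is read on the whole collar `{D < δ}` of the good fibre — here only on `closure (fibre ∩ histGood) ∩ {δ-tube} ∩ {D ≤ r}`.
* §3 ★★★ `gapFlatAt_of_pos_of_atMostOneCriticalOrbit_of_closePair` — §2 ∘ ✓`orbBar_of_atMostOneCriticalOrbit`: GAP♭(V,U₀) ⟸ {POS∘(U₀), Prop. 7 cl. 1 at `V`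
  (`(varProblem3 F J K hJK).AtMostOneCriticalOrbit ε₀ V`), `U₀` a (6)-regular (6)-minimiser and good history, REG-ARGMIN̄(V), CL(V)}.
* §4 ★★ `gapFlatAt_one_of_pos_of_prop7At_of_closePair` — the flat corner `V ≡ 1, U₀ = 1`: GAP♭(1,1) ⟸ {POS∘(1) on the `δ`-tube collar, `Prop7AtMostOneCriticalOrbitAt L a₀ B₃`,
  CL(1)} for `0 < γ ≤ min γ₁ 1`, `J < K`, `0 < ε₀ ≤ a₀` (REG-ARGMIN̄(1) and `1 ∈ argminHist 1` are free: ✓`orbBar_one_of_prop7At`, ✓`one_mem_argmin_one`) — the socket into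
  which the flat Hessian-kernel theorem (px16 g17's Q-KERNEL♭ `exists_rooted_eq_grad_of_curl_eq_zero_of_linAvg_eq_zero`) feeds POS∘(1) after the (T1)∕(T2) chart bridge.

HONEST: set bookkeeping (three compositions and one ten-line lemma); POS∘ (print's (142) — positivity of the constrained Hessian at the regular minimiser), Prop. 7 cl. 1,
REG-ARGMIN̄ at the crux's depth and CL are DISPLAYED HYPOTHESES, NOT proved here; TUBE-REG∘, GAP♯∘ (the registry organ, with its `K`-uniform modulus), EXW∘, S2β, crux 20520
NOT proved; no summit statement is proved by a helper; finite volume ∕ conditional; rung R3 = SU(2) YM₃ on T³ — NOT d = 4, NOT infinite volume, NOT a mass gap, NOT Clay; the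
Yang–Mills mass gap is NOT proved.  Sorry-free, axioms standard.

References: T. Bałaban, CMP **102** (1985) 277–309 [Balaban1985Variational] (Thm 1 (8)–(10) p.279, Prop. 7 and (142) p.299); CMP **102** (1985) 255–275 [Balaban1985UV3]
((12)–(13) p.259, (18)–(22) p.260).
-/

set_option autoImplicit false

namespace Summit.QuantumFields.YangMills.Theorems.FluctuationComparisonRegPrIntLIsolOfOrbBar

open Set
open Literature.MathematicalPhysics.QuantumFieldTheory.Balaban1983to89
open Literature.MathematicalPhysics.QuantumFieldTheory.Balaban1983to89.T3ContinuumYM3Torus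
open Literature.MathematicalPhysics.QuantumFieldTheory.Balaban1983to89.T3UnitLawDensityEML (ℰp)
open Literature.MathematicalPhysics.QuantumFieldTheory.Balaban1983to89.T3UnitScaleTilt
open Literature.MathematicalPhysics.QuantumFieldTheory.Balaban1983to89.T3TiltDescent
open Literature.MathematicalPhysics.QuantumFieldTheory.Balaban1983to89.T3ConstrainedMinimiser (fibre)
open Literature.MathematicalPhysics.QuantumFieldTheory.Balaban1983to89.T3PrintedRegularMinimiser
open Literature.MathematicalPhysics.QuantumFieldTheory.Balaban1983to89.T3Thm1Carrier (varProblem3)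
open Literature.MathematicalPhysics.QuantumFieldTheory.Balaban1983to89.T3Thm1UniquenessSchema (Prop7AtMostOneCriticalOrbitAt)
open Literature.MathematicalPhysics.QuantumFieldTheory.Balaban1983to89.T4Continuum
open Summit.QuantumFields.YangMills.Theorems.FluctuationComparisonRegPrIntLS2BetaResidualGaugeOrbit (iInf_orbitDistSq_eq_zero_of_residual)
open Summit.QuantumFields.YangMills.Theorems.FluctuationComparisonRegPrIntLS2BetaTubeGrowthOfIsolated
  (tubeGrowth_of_pos_of_isolated gapFlatAt_of_pos_of_isolated_of_closePair)
open Summit.QuantumFields.YangMills.Theorems.FluctuationComparisonRegPrIntLOrbBarOfRegArgminBar (orbBar_of_atMostOneCriticalOrbit orbBar_one_of_prop7At)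
open Summit.QuantumFields.YangMills.Theorems.FluctuationComparisonRegPrIntLRegArgminFlat (one_mem_argmin_one)

/-! ## §1 ISOL∘(δ) from ORB̄, and the tube growth from POS∘ ∧ ORB̄ -/

section Isol

variable (F : T3Family) {J K : ℕ} (hJK : J ≤ K) {γ b₀ p₀ ε₀ : ℝ}

/-- ★★ **ISOL∘(δ) ⟸ ORB̄(V,U₀), FOR EVERY `δ`.**  If every closed-window achiever (`U ∈ closure (fibre V ∩ histGood)`, `A U ≤ min₍₆₎`) is a residual translate `w • U₀`, then at
every such achiever the orbit functional `⨅_{w residual} Σ_ℓ dist1 (U ℓ·((w•U₀) ℓ)⁻¹)²` vanishes — in particular inside any `δ`-tube (the tube hypothesis is not used).  This is the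
`hisol` letter of ✓`tubeGrowth_of_pos_of_isolated`, token for token. [cite: Balaban1985Variational, Prop. 7 p.299; Balaban1985UV3, (12)-(13) p.259] -/
theorem isol_of_orbBar
    (V : GaugeField (F.P J) 0 (Matrix.specialUnitaryGroup (Fin 2) ℂ)) (U₀ : GaugeField (F.P K) 0 (Matrix.specialUnitaryGroup (Fin 2) ℂ)) (δ : ℝ)
    (hOrb : ∀ U ∈ closure (fibre F ℰp J K hJK V ∩ histGood F ℰp (θBal F.L γ b₀ p₀) K J),
      wilsonAction4 U ≤ minActionRegPr F J K hJK ε₀ V →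
        ∃ w : Site (F.P K) 0 → Matrix.specialUnitaryGroup (Fin 2) ℂ,
          (∀ U' : GaugeField (F.P K) 0 (Matrix.specialUnitaryGroup (Fin 2) ℂ),
              descendTo F ℰp J K hJK (GaugeField.gaugeAct w U') = descendTo F ℰp J K hJK U') ∧
            U = GaugeField.gaugeAct w U₀) :
    ∀ U ∈ closure (fibre F ℰp J K hJK V ∩ histGood F ℰp (θBal F.L γ b₀ p₀) K J),
        (∃ w : Site (F.P K) 0 → Matrix.specialUnitaryGroup (Fin 2) ℂ,
          (∀ U'' : GaugeField (F.P K) 0 (Matrix.specialUnitaryGroup (Fin 2) ℂ),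
              descendTo F ℰp J K hJK (GaugeField.gaugeAct w U'') = descendTo F ℰp J K hJK U'') ∧
            ∀ ℓ : PBond (F.P K) 0, dist1 (U ℓ * ((GaugeField.gaugeAct w U₀) ℓ)⁻¹) ≤ δ) →
        wilsonAction4 U ≤ minActionRegPr F J K hJK ε₀ V →
        (⨅ w : {w : Site (F.P K) 0 → Matrix.specialUnitaryGroup (Fin 2) ℂ |
            ∀ U : GaugeField (F.P K) 0 (Matrix.specialUnitaryGroup (Fin 2) ℂ),
              descendTo F ℰp J K hJK (GaugeField.gaugeAct w U) = descendTo F ℰp J K hJK U},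
          ∑ ℓ : PBond (F.P K) 0,
            dist1 (U ℓ * ((GaugeField.gaugeAct (w : Site (F.P K) 0 → Matrix.specialUnitaryGroup (Fin 2) ℂ) U₀) ℓ)⁻¹) ^ 2) = 0 := by
  intro U hU _hUtube hle
  obtain ⟨w, hw, rfl⟩ := hOrb U hU hle
  exact iInf_orbitDistSq_eq_zero_of_residual F hJK hw U₀

/-- ★★ **TUBE♭(V,U₀) ⟸ POS∘(U₀) ∧ ORB̄(V,U₀).**  ✓`tubeGrowth_of_pos_of_isolated` with its isolation letter discharged by `isol_of_orbBar`: collar growth on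
`closure (fibre ∩ histGood) ∩ {δ-tube} ∩ {D ≤ r}` and the closed-window orbit letter give `∃ μ > 0, μ·L^{−2(K−J)}·D U ≤ A U − min` for every good history `U` of the fibre in the
`δ`-tube. [cite: Balaban1985Variational, (142) p.299; Balaban1985UV3, (18)-(22) p.260] -/
theorem tubeFlatAt_of_pos_of_orbBar
    (V : GaugeField (F.P J) 0 (Matrix.specialUnitaryGroup (Fin 2) ℂ)) (U₀ : GaugeField (F.P K) 0 (Matrix.specialUnitaryGroup (Fin 2) ℂ)) (δ : ℝ)
    (hpos : ∃ r c : ℝ, 0 < r ∧ 0 < c ∧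
      ∀ U ∈ closure (fibre F ℰp J K hJK V ∩ histGood F ℰp (θBal F.L γ b₀ p₀) K J),
        (∃ w : Site (F.P K) 0 → Matrix.specialUnitaryGroup (Fin 2) ℂ,
          (∀ U'' : GaugeField (F.P K) 0 (Matrix.specialUnitaryGroup (Fin 2) ℂ),
              descendTo F ℰp J K hJK (GaugeField.gaugeAct w U'') = descendTo F ℰp J K hJK U'') ∧
            ∀ ℓ : PBond (F.P K) 0, dist1 (U ℓ * ((GaugeField.gaugeAct w U₀) ℓ)⁻¹) ≤ δ) →
        (⨅ w : {w : Site (F.P K) 0 → Matrix.specialUnitaryGroup (Fin 2) ℂ |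
            ∀ U : GaugeField (F.P K) 0 (Matrix.specialUnitaryGroup (Fin 2) ℂ),
              descendTo F ℰp J K hJK (GaugeField.gaugeAct w U) = descendTo F ℰp J K hJK U},
          ∑ ℓ : PBond (F.P K) 0,
            dist1 (U ℓ * ((GaugeField.gaugeAct (w : Site (F.P K) 0 → Matrix.specialUnitaryGroup (Fin 2) ℂ) U₀) ℓ)⁻¹) ^ 2) ≤ r →
        c * (⨅ w : {w : Site (F.P K) 0 → Matrix.specialUnitaryGroup (Fin 2) ℂ |
            ∀ U : GaugeField (F.P K) 0 (Matrix.specialUnitaryGroup (Fin 2) ℂ),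
              descendTo F ℰp J K hJK (GaugeField.gaugeAct w U) = descendTo F ℰp J K hJK U},
          ∑ ℓ : PBond (F.P K) 0,
            dist1 (U ℓ * ((GaugeField.gaugeAct (w : Site (F.P K) 0 → Matrix.specialUnitaryGroup (Fin 2) ℂ) U₀) ℓ)⁻¹) ^ 2)
          ≤ wilsonAction4 U - minActionRegPr F J K hJK ε₀ V)
    (hOrb : ∀ U ∈ closure (fibre F ℰp J K hJK V ∩ histGood F ℰp (θBal F.L γ b₀ p₀) K J),
      wilsonAction4 U ≤ minActionRegPr F J K hJK ε₀ V →
        ∃ w : Site (F.P K) 0 → Matrix.specialUnitaryGroup (Fin 2) ℂ,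
          (∀ U' : GaugeField (F.P K) 0 (Matrix.specialUnitaryGroup (Fin 2) ℂ),
              descendTo F ℰp J K hJK (GaugeField.gaugeAct w U') = descendTo F ℰp J K hJK U') ∧
            U = GaugeField.gaugeAct w U₀) :
    ∃ μ : ℝ, 0 < μ ∧ ∀ U ∈ fibre F ℰp J K hJK V, U ∈ histGood F ℰp (θBal F.L γ b₀ p₀) K J →
      (∃ w : Site (F.P K) 0 → Matrix.specialUnitaryGroup (Fin 2) ℂ,
        (∀ U'' : GaugeField (F.P K) 0 (Matrix.specialUnitaryGroup (Fin 2) ℂ),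
            descendTo F ℰp J K hJK (GaugeField.gaugeAct w U'') = descendTo F ℰp J K hJK U'') ∧
          ∀ ℓ : PBond (F.P K) 0, dist1 (U ℓ * ((GaugeField.gaugeAct w U₀) ℓ)⁻¹) ≤ δ) →
      μ * ((F.L : ℝ)⁻¹) ^ (2 * (K - J)) *
          (⨅ w : {w : Site (F.P K) 0 → Matrix.specialUnitaryGroup (Fin 2) ℂ |
              ∀ U : GaugeField (F.P K) 0 (Matrix.specialUnitaryGroup (Fin 2) ℂ),
                descendTo F ℰp J K hJK (GaugeField.gaugeAct w U) = descendTo F ℰp J K hJK U},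
            ∑ ℓ : PBond (F.P K) 0,
              dist1 (U ℓ * ((GaugeField.gaugeAct (w : Site (F.P K) 0 → Matrix.specialUnitaryGroup (Fin 2) ℂ) U₀) ℓ)⁻¹) ^ 2)
        ≤ wilsonAction4 U - minActionRegPr F J K hJK ε₀ V :=
  tubeGrowth_of_pos_of_isolated F hJK V U₀ δ hpos (isol_of_orbBar F hJK V U₀ δ hOrb)

end Isol

/-! ## §2 GAP♭ ⟸ {POS∘, ORB̄} for `γ ≤ γ₁(δ)` of CLOSE-PAIR∘ -/

section GapFlat

/-- ★★★ **GAP♭(V,U₀) ⟸ POS∘(U₀) ∧ ORB̄(V,U₀), FOR `γ ≤ γ₁(L, b₀, p₀, δ)` OF CLOSE-PAIR∘.**  For every `L`, `b₀, p₀ > 0` and every tube radius `δ > 0` there is `γ₁ > 0` (that of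
✓`closePair_holds`) such that at every datum `V` of every run with `γ ≤ γ₁` and every base point `U₀` which is a good history of the fibre: collar growth on the `δ`-tube
(`hpos`, POS∘) and the closed-window orbit letter (`hOrb`, ORB̄) give `∃ μ > 0, μ·L^{−2(K−J)}·⨅_w Σ dist1² ≤ A U − min` for EVERY good history `U` of the fibre — ✓px8's
`gapFlatAt_of_pos_of_isolated_of_closePair` with ISOL∘(δ) discharged by `isol_of_orbBar`. [cite: Balaban1985UV3, (12)-(13) p.259, (18)-(22) p.260; Balaban1985Variational, Prop. 7 and (142) p.299] -/
theorem gapFlatAt_of_pos_of_orbBar_of_closePair (L : ℕ) (b₀ p₀ : ℝ) (hb₀ : 0 < b₀) (hp₀ : 0 < p₀) (δ : ℝ) (hδ : 0 < δ) :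
    ∃ γ₁ : ℝ, 0 < γ₁ ∧ ∀ (F : T3Family) (γ : ℝ), F.L = L → 0 < γ → γ ≤ γ₁ →
      ∀ (J K : ℕ) (hJK : J ≤ K) (ε₀ : ℝ) (V : GaugeField (F.P J) 0 (Matrix.specialUnitaryGroup (Fin 2) ℂ)),
        ∀ U₀ ∈ fibre F ℰp J K hJK V, U₀ ∈ histGood F ℰp (θBal F.L γ b₀ p₀) K J →
        (∃ r c : ℝ, 0 < r ∧ 0 < c ∧
          ∀ U ∈ closure (fibre F ℰp J K hJK V ∩ histGood F ℰp (θBal F.L γ b₀ p₀) K J),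
            (∃ w : Site (F.P K) 0 → Matrix.specialUnitaryGroup (Fin 2) ℂ,
              (∀ U'' : GaugeField (F.P K) 0 (Matrix.specialUnitaryGroup (Fin 2) ℂ),
                  descendTo F ℰp J K hJK (GaugeField.gaugeAct w U'') = descendTo F ℰp J K hJK U'') ∧
                ∀ ℓ : PBond (F.P K) 0, dist1 (U ℓ * ((GaugeField.gaugeAct w U₀) ℓ)⁻¹) ≤ δ) →
            (⨅ w : {w : Site (F.P K) 0 → Matrix.specialUnitaryGroup (Fin 2) ℂ |
                ∀ U : GaugeField (F.P K) 0 (Matrix.specialUnitaryGroup (Fin 2) ℂ),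
                  descendTo F ℰp J K hJK (GaugeField.gaugeAct w U) = descendTo F ℰp J K hJK U},
              ∑ ℓ : PBond (F.P K) 0,
                dist1 (U ℓ * ((GaugeField.gaugeAct (w : Site (F.P K) 0 → Matrix.specialUnitaryGroup (Fin 2) ℂ) U₀) ℓ)⁻¹) ^ 2) ≤ r →
            c * (⨅ w : {w : Site (F.P K) 0 → Matrix.specialUnitaryGroup (Fin 2) ℂ |
                ∀ U : GaugeField (F.P K) 0 (Matrix.specialUnitaryGroup (Fin 2) ℂ),
                  descendTo F ℰp J K hJK (GaugeField.gaugeAct w U) = descendTo F ℰp J K hJK U},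
              ∑ ℓ : PBond (F.P K) 0,
                dist1 (U ℓ * ((GaugeField.gaugeAct (w : Site (F.P K) 0 → Matrix.specialUnitaryGroup (Fin 2) ℂ) U₀) ℓ)⁻¹) ^ 2)
              ≤ wilsonAction4 U - minActionRegPr F J K hJK ε₀ V) →
        (∀ U ∈ closure (fibre F ℰp J K hJK V ∩ histGood F ℰp (θBal F.L γ b₀ p₀) K J),
          wilsonAction4 U ≤ minActionRegPr F J K hJK ε₀ V →
            ∃ w : Site (F.P K) 0 → Matrix.specialUnitaryGroup (Fin 2) ℂ,
              (∀ U' : GaugeField (F.P K) 0 (Matrix.specialUnitaryGroup (Fin 2) ℂ),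
                  descendTo F ℰp J K hJK (GaugeField.gaugeAct w U') = descendTo F ℰp J K hJK U') ∧
                U = GaugeField.gaugeAct w U₀) →
        ∃ μ : ℝ, 0 < μ ∧ ∀ U ∈ fibre F ℰp J K hJK V, U ∈ histGood F ℰp (θBal F.L γ b₀ p₀) K J →
          μ * ((F.L : ℝ)⁻¹) ^ (2 * (K - J)) *
              (⨅ w : {w : Site (F.P K) 0 → Matrix.specialUnitaryGroup (Fin 2) ℂ |
                  ∀ U : GaugeField (F.P K) 0 (Matrix.specialUnitaryGroup (Fin 2) ℂ),
                    descendTo F ℰp J K hJK (GaugeField.gaugeAct w U) = descendTo F ℰp J K hJK U},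
                ∑ ℓ : PBond (F.P K) 0,
                  dist1 (U ℓ * ((GaugeField.gaugeAct (w : Site (F.P K) 0 → Matrix.specialUnitaryGroup (Fin 2) ℂ) U₀) ℓ)⁻¹) ^ 2)
            ≤ wilsonAction4 U - minActionRegPr F J K hJK ε₀ V := by
  obtain ⟨γ₁, hγ₁, h⟩ := gapFlatAt_of_pos_of_isolated_of_closePair L b₀ p₀ hb₀ hp₀ δ hδ
  exact ⟨γ₁, hγ₁, fun F γ hFL hγ hγle J K hJK ε₀ V U₀ hU₀f hU₀g hpos hOrb =>
    h F γ hFL hγ hγle J K hJK ε₀ V U₀ hU₀f hU₀g hpos (isol_of_orbBar F hJK V U₀ δ hOrb)⟩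

end GapFlat

/-! ## §3 GAP♭ ⟸ {POS∘, Prop. 7 cl. 1, REG-ARGMIN̄, CL} -/

section Prop7

/-- ★★★ **GAP♭(V,U₀) ⟸ POS∘(U₀) ∧ PROP. 7 CL. 1 ∧ REG-ARGMIN̄(V) ∧ CL(V), FOR `γ ≤ γ₁(L, b₀, p₀, δ)`.**  §2 composed with ✓`orbBar_of_atMostOneCriticalOrbit`: at a datum `V`
where print's Prop. 7 cl. 1 holds in the form «at most one `ε₀`-regular critical orbit of the variational problem (6)» (`h7`), every closed-window achiever is (6)-regular (`hRA`,
REG-ARGMIN̄) and the closed good fibre stays in the fibre (`hCL`, CL), a (6)-regular (6)-minimiser `U₀` which is a good history carries the per-datum gap as soon as POS∘(U₀)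
holds on the `δ`-tube collar.  ISOL∘ is no longer a hypothesis. [cite: Balaban1985Variational, Thm 1 (8) p.279, Prop. 7 and (142) p.299; Balaban1985UV3, (12)-(13) p.259] -/
theorem gapFlatAt_of_pos_of_atMostOneCriticalOrbit_of_closePair (L : ℕ) (b₀ p₀ : ℝ) (hb₀ : 0 < b₀) (hp₀ : 0 < p₀) (δ : ℝ) (hδ : 0 < δ) :
    ∃ γ₁ : ℝ, 0 < γ₁ ∧ ∀ (F : T3Family) (γ : ℝ), F.L = L → 0 < γ → γ ≤ γ₁ →
      ∀ (J K : ℕ) (hJK : J ≤ K) (ε₀ : ℝ), 0 < ε₀ → ∀ (V : GaugeField (F.P J) 0 (Matrix.specialUnitaryGroup (Fin 2) ℂ)),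
        (varProblem3 F J K hJK).AtMostOneCriticalOrbit ε₀ V →
        ∀ U₀ ∈ regFibrePr F J K hJK ε₀ V, wilsonAction4 U₀ = minActionRegPr F J K hJK ε₀ V → U₀ ∈ histGood F ℰp (θBal F.L γ b₀ p₀) K J →
        (∀ U ∈ closure (fibre F ℰp J K hJK V ∩ histGood F ℰp (θBal F.L γ b₀ p₀) K J),
          wilsonAction4 U ≤ minActionRegPr F J K hJK ε₀ V → RegPr F J K ε₀ U) →
        closure (fibre F ℰp J K hJK V ∩ histGood F ℰp (θBal F.L γ b₀ p₀) K J) ⊆ fibre F ℰp J K hJK V →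
        (∃ r c : ℝ, 0 < r ∧ 0 < c ∧
          ∀ U ∈ closure (fibre F ℰp J K hJK V ∩ histGood F ℰp (θBal F.L γ b₀ p₀) K J),
            (∃ w : Site (F.P K) 0 → Matrix.specialUnitaryGroup (Fin 2) ℂ,
              (∀ U'' : GaugeField (F.P K) 0 (Matrix.specialUnitaryGroup (Fin 2) ℂ),
                  descendTo F ℰp J K hJK (GaugeField.gaugeAct w U'') = descendTo F ℰp J K hJK U'') ∧
                ∀ ℓ : PBond (F.P K) 0, dist1 (U ℓ * ((GaugeField.gaugeAct w U₀) ℓ)⁻¹) ≤ δ) →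
            (⨅ w : {w : Site (F.P K) 0 → Matrix.specialUnitaryGroup (Fin 2) ℂ |
                ∀ U : GaugeField (F.P K) 0 (Matrix.specialUnitaryGroup (Fin 2) ℂ),
                  descendTo F ℰp J K hJK (GaugeField.gaugeAct w U) = descendTo F ℰp J K hJK U},
              ∑ ℓ : PBond (F.P K) 0,
                dist1 (U ℓ * ((GaugeField.gaugeAct (w : Site (F.P K) 0 → Matrix.specialUnitaryGroup (Fin 2) ℂ) U₀) ℓ)⁻¹) ^ 2) ≤ r →
            c * (⨅ w : {w : Site (F.P K) 0 → Matrix.specialUnitaryGroup (Fin 2) ℂ |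
                ∀ U : GaugeField (F.P K) 0 (Matrix.specialUnitaryGroup (Fin 2) ℂ),
                  descendTo F ℰp J K hJK (GaugeField.gaugeAct w U) = descendTo F ℰp J K hJK U},
              ∑ ℓ : PBond (F.P K) 0,
                dist1 (U ℓ * ((GaugeField.gaugeAct (w : Site (F.P K) 0 → Matrix.specialUnitaryGroup (Fin 2) ℂ) U₀) ℓ)⁻¹) ^ 2)
              ≤ wilsonAction4 U - minActionRegPr F J K hJK ε₀ V) →
        ∃ μ : ℝ, 0 < μ ∧ ∀ U ∈ fibre F ℰp J K hJK V, U ∈ histGood F ℰp (θBal F.L γ b₀ p₀) K J →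
          μ * ((F.L : ℝ)⁻¹) ^ (2 * (K - J)) *
              (⨅ w : {w : Site (F.P K) 0 → Matrix.specialUnitaryGroup (Fin 2) ℂ |
                  ∀ U : GaugeField (F.P K) 0 (Matrix.specialUnitaryGroup (Fin 2) ℂ),
                    descendTo F ℰp J K hJK (GaugeField.gaugeAct w U) = descendTo F ℰp J K hJK U},
                ∑ ℓ : PBond (F.P K) 0,
                  dist1 (U ℓ * ((GaugeField.gaugeAct (w : Site (F.P K) 0 → Matrix.specialUnitaryGroup (Fin 2) ℂ) U₀) ℓ)⁻¹) ^ 2)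
            ≤ wilsonAction4 U - minActionRegPr F J K hJK ε₀ V := by
  obtain ⟨γ₁, hγ₁, h⟩ := gapFlatAt_of_pos_of_orbBar_of_closePair L b₀ p₀ hb₀ hp₀ δ hδ
  refine ⟨γ₁, hγ₁, fun F γ hFL hγ hγle J K hJK ε₀ hε₀ V h7 U₀ hU₀ hU₀min hU₀g hRA hCL hpos => ?_⟩
  exact h F γ hFL hγ hγle J K hJK ε₀ V U₀ ((mem_regFibrePr_iff F).mp hU₀).1 hU₀g hpos
    (orbBar_of_atMostOneCriticalOrbit F hJK hε₀ h7 hU₀ hU₀min hRA hCL)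

end Prop7

/-! ## §4 The flat corner `V ≡ 1`, `U₀ = 1` -/

section Flat

/-- ★★ **GAP♭(1,1) ⟸ POS∘(1) ∧ `Prop7AtMostOneCriticalOrbitAt L a₀ B₃` ∧ CL(1), FOR `0 < γ ≤ min γ₁ 1`, `J < K`, `0 < ε₀ ≤ a₀`.**  At the flat datum the orbit letter ORB̄(1,1) is
✓`orbBar_one_of_prop7At` (REG-ARGMIN̄(1) free) and `1` is a good history of its own fibre attaining the (6)-minimum (✓`one_mem_argmin_one`), so the per-datum gap about the
residual orbit of `1` follows from collar growth POS∘(1) on the `δ`-tube alone — the socket for the flat Hessian-kernel theorem after the chart bridge.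
[cite: Balaban1985Variational, Prop. 7 and (142) p.299; Balaban1985UV3, (12)-(13) p.259, (18)-(22) p.260] -/
theorem gapFlatAt_one_of_pos_of_prop7At_of_closePair {L : ℕ} {a₀ B₃ : ℝ} (h7 : Prop7AtMostOneCriticalOrbitAt L a₀ B₃) (hB₃ : 0 < B₃)
    (b₀ p₀ : ℝ) (hb₀ : 0 < b₀) (hp₀ : 0 < p₀) (δ : ℝ) (hδ : 0 < δ) :
    ∃ γ₁ : ℝ, 0 < γ₁ ∧ ∀ (F : T3Family) (γ : ℝ), F.L = L → 0 < γ → γ ≤ γ₁ →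
      ∀ (J K : ℕ) (hlt : J < K) (ε₀ : ℝ), 0 < ε₀ → ε₀ ≤ a₀ →
        closure (fibre F ℰp J K hlt.le 1 ∩ histGood F ℰp (θBal F.L γ b₀ p₀) K J) ⊆ fibre F ℰp J K hlt.le 1 →
        (∃ r c : ℝ, 0 < r ∧ 0 < c ∧
          ∀ U ∈ closure (fibre F ℰp J K hlt.le 1 ∩ histGood F ℰp (θBal F.L γ b₀ p₀) K J),
            (∃ w : Site (F.P K) 0 → Matrix.specialUnitaryGroup (Fin 2) ℂ,
              (∀ U'' : GaugeField (F.P K) 0 (Matrix.specialUnitaryGroup (Fin 2) ℂ),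
                  descendTo F ℰp J K hlt.le (GaugeField.gaugeAct w U'') = descendTo F ℰp J K hlt.le U'') ∧
                ∀ ℓ : PBond (F.P K) 0,
                  dist1 (U ℓ * ((GaugeField.gaugeAct w (1 : GaugeField (F.P K) 0 (Matrix.specialUnitaryGroup (Fin 2) ℂ))) ℓ)⁻¹) ≤ δ) →
            (⨅ w : {w : Site (F.P K) 0 → Matrix.specialUnitaryGroup (Fin 2) ℂ |
                ∀ U : GaugeField (F.P K) 0 (Matrix.specialUnitaryGroup (Fin 2) ℂ),
                  descendTo F ℰp J K hlt.le (GaugeField.gaugeAct w U) = descendTo F ℰp J K hlt.le U},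
              ∑ ℓ : PBond (F.P K) 0,
                dist1 (U ℓ * ((GaugeField.gaugeAct (w : Site (F.P K) 0 → Matrix.specialUnitaryGroup (Fin 2) ℂ)
                  (1 : GaugeField (F.P K) 0 (Matrix.specialUnitaryGroup (Fin 2) ℂ))) ℓ)⁻¹) ^ 2) ≤ r →
            c * (⨅ w : {w : Site (F.P K) 0 → Matrix.specialUnitaryGroup (Fin 2) ℂ |
                ∀ U : GaugeField (F.P K) 0 (Matrix.specialUnitaryGroup (Fin 2) ℂ),
                  descendTo F ℰp J K hlt.le (GaugeField.gaugeAct w U) = descendTo F ℰp J K hlt.le U},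
              ∑ ℓ : PBond (F.P K) 0,
                dist1 (U ℓ * ((GaugeField.gaugeAct (w : Site (F.P K) 0 → Matrix.specialUnitaryGroup (Fin 2) ℂ)
                  (1 : GaugeField (F.P K) 0 (Matrix.specialUnitaryGroup (Fin 2) ℂ))) ℓ)⁻¹) ^ 2)
              ≤ wilsonAction4 U - minActionRegPr F J K hlt.le ε₀ 1) →
        ∃ μ : ℝ, 0 < μ ∧ ∀ U ∈ fibre F ℰp J K hlt.le 1, U ∈ histGood F ℰp (θBal F.L γ b₀ p₀) K J →
          μ * ((F.L : ℝ)⁻¹) ^ (2 * (K - J)) *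
              (⨅ w : {w : Site (F.P K) 0 → Matrix.specialUnitaryGroup (Fin 2) ℂ |
                  ∀ U : GaugeField (F.P K) 0 (Matrix.specialUnitaryGroup (Fin 2) ℂ),
                    descendTo F ℰp J K hlt.le (GaugeField.gaugeAct w U) = descendTo F ℰp J K hlt.le U},
                ∑ ℓ : PBond (F.P K) 0,
                  dist1 (U ℓ * ((GaugeField.gaugeAct (w : Site (F.P K) 0 → Matrix.specialUnitaryGroup (Fin 2) ℂ)
                    (1 : GaugeField (F.P K) 0 (Matrix.specialUnitaryGroup (Fin 2) ℂ))) ℓ)⁻¹) ^ 2)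
            ≤ wilsonAction4 U - minActionRegPr F J K hlt.le ε₀ 1 := by
  obtain ⟨γ₁, hγ₁, h⟩ := gapFlatAt_of_pos_of_orbBar_of_closePair L b₀ p₀ hb₀ hp₀ δ hδ
  refine ⟨min γ₁ 1, lt_min hγ₁ one_pos, fun F γ hFL hγ hγle J K hlt ε₀ hε₀ hε₀a hCL hpos => ?_⟩
  have h1 := one_mem_argmin_one F hlt.le (γ := γ) (b₀ := b₀) (p₀ := p₀) (ε₀ := ε₀) hγ (hγle.trans (min_le_right _ _)) hb₀ hε₀
  exact h F γ hFL hγ (hγle.trans (min_le_left _ _)) J K hlt.le ε₀ 1 1 h1.1 h1.2.1 hpos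
    (orbBar_one_of_prop7At F h7 hB₃ hFL hlt hε₀ hε₀a hCL)

end Flat

end Summit.QuantumFields.YangMills.Theorems.FluctuationComparisonRegPrIntLIsolOfOrbBar
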